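import Literature.MathematicalPhysics.QuantumLattice.HubbardUVWeightJetsGeometric
import Literature.MathematicalPhysics.QuantumLattice.HubbardUVSymbolResummedLipschitz
import Literature.MathematicalPhysics.QuantumLattice.HubbardResolventJets
import HarnessLib

/-!
# Jets of the MISMATCH-RESUMMED ultraviolet symbol along a pair of smooth bands:
# `p ↦ Ψ̃(p) = w(ω, u(p))·c/(−iω + u(p) + w(ω,u(p))·v(p))` has `‖Dⁿ Ψ̃(p)‖ ≤ |c|·X·(n!)³·(6/Λ)^{n+1}·(4E_u/Λ + D_φ)ⁿ`

Topic `MathematicalPhysics/QuantumLattice`; sequel of `HubbardUVSymbolResummedLipschitz` (`uvResummedFn c Λ ω ξ x = Ψ(ω, ξ−x)/(1 + Ψ(ω,ξ−x)·x/c)`, the symbol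
of the covariance in which the quadratic MISMATCH `x` of two counterterm frames is resummed; value and Lipschitz bounds) and of the geometric jet envelopes
`HubbardUVWeightJetsGeometric` / `HubbardUVSymbolJetsGeometric`.  For the sup/aliasing route of the K3 two-leg reading (cell gate-hubbard-kl, stub (C)
«(C)-B-REP», memo SUP-ROUTE-SPEC §2(c) step S-c2b) the resummed symbol is read ALONG THE FRAMES: `ξ − x = u(p)` (the new frame's band `e_{K₂}`), `x = v(p)` (the
mismatch `D = K₂ ⊖ K₁`), both smooth on a real normed space `E` (the momentum plane).  Written as WEIGHT × RESOLVENT of the REAL shifted band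
`φ = u + w(ω,u)·v` (`uvResummedFn_eq_weight_mul_resolvent`), its jets follow from Mathlib's `norm_iteratedFDeriv_comp_le` / `norm_iteratedFDeriv_mul_le`:

* `uvResummedFn_eq_weight_mul_resolvent` — `Ψ̃ = w(ω,e₂)·c/(−iω + e₂ + w(ω,e₂)x)`, `e₂ = ξ − x` (`ω ≠ 0`);
* `norm_shiftDen_resummed_ge` — on the closed shell `Λ²/4 ≤ ω² + e₂²`, with `|x| ≤ Λ/4`: `‖−iω + (e₂ + w·x)‖ ≥ Λ/6`;
* `norm_iteratedFDeriv_weight_comp_le` — `‖Dⁱ(w(ω,u ·))(p)‖ ≤ (i!)²·X·(4E_u/Λ)ⁱ` (band jets `‖Dʲu‖ ≤ E_uʲ`, `E_u ≥ 1`, `Λ ≤ 4`);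
* `norm_iteratedFDeriv_shiftedBand_le` — `‖Dʲφ(p)‖ ≤ D_φʲ`, `D_φ = (1 + δX)·(n!)²·(E_u + F_v + 4E_u/Λ)` (`j ≤ n`, mismatch jets `‖Dʲv‖ ≤ δ·F_vʲ`, `F_v ≥ 1`);
* **`norm_iteratedFDeriv_uvResummed_comp_le`** — for `|v(p)| ≤ δ ≤ Λ/4`:
  `‖Dⁿ[p ↦ w(ω,u p)·resolventFnXi c 0 ω (u p + w(ω,u p)·v p)](p)‖ ≤ |c|·X·(n!)³·(6/Λ)^{n+1}·(4E_u/Λ + D_φ)ⁿ`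
  (below the shell the function vanishes identically near `p`; on and above it the resolvent jets at `φ(p)` are `≤ |c|·j!·(6/Λ)^{j+1}`).

Everything is proved; no definitions; no named facts.

## Sources

G. Benfatto, A. Giuliani, V. Mastropietro, Ann. Henri Poincaré 7 (2006) 809–898, §2.2 (2.23), (2.27)–(2.28), (2.36aa) [`BenfattoGiulianiMastropietro2006`];
J. Feldman, M. Salmhofer, E. Trubowitz, J. Stat. Phys. 84 (1996) 1209–1336, §1 (moving the counterterm between covariance and interaction) [`FeldmanSalmhoferTrubowitz1996`].
-/

noncomputable section

namespace Literature.MathematicalPhysics.QuantumLattice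

open Complex Finset

variable {c Λ ω : ℝ}

/-! ## §1 The resummed symbol as weight × resolvent of the shifted band -/

/-- **`Ψ̃ = w(ω,e₂)·c/(−iω + e₂ + w(ω,e₂)·x)`**, `e₂ = ξ − x` (`ω ≠ 0`). [cite: BenfattoGiulianiMastropietro2006, §2.2 (2.23)] -/
theorem uvResummedFn_eq_weight_mul_resolvent (hω : ω ≠ 0) (c Λ ξ x : ℝ) :
    uvResummedFn c Λ ω ξ x =
      ((uvWeightFn Λ ω (ξ - x) : ℝ) : ℂ) * resolventFnXi c 0 ω ((ξ - x) + uvWeightFn Λ ω (ξ - x) * x) := by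
  have hω0 : ω + 0 ≠ 0 := by rwa [add_zero]
  have hW : uvWeightFn Λ (ξ - x) ω = uvWeightFn Λ ω (ξ - x) := by simp only [uvWeightFn, add_comm]
  rw [uvResummedFn, uvSymbolFn, resolventFn, resolventFnXi, hW]
  set W : ℝ := uvWeightFn Λ ω (ξ - x) with hWdef
  set z : ℂ := -I * ((ω + 0 : ℝ) : ℂ) + ((ξ - x : ℝ) : ℂ) with hzdef
  have hz : z ≠ 0 := shiftDen_ne_zero_of_freq_ne hω0 _
  have hz'eq : (-I * ((ω + 0 : ℝ) : ℂ) + (((ξ - x) + W * x : ℝ) : ℂ)) = z + (W : ℂ) * (x : ℂ) := by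
    rw [hzdef]; push_cast; ring
  have hz' : z + (W : ℂ) * (x : ℂ) ≠ 0 := by rw [← hz'eq]; exact shiftDen_ne_zero_of_freq_ne hω0 _
  have hxc : (((x / c : ℝ)) : ℂ) = (x : ℂ) / (c : ℂ) := Complex.ofReal_div x c
  rw [hz'eq, hxc]
  by_cases hc : c = 0
  · simp [hc]
  have hc' : (c : ℂ) ≠ 0 := by exact_mod_cast hc
  have key : (1 : ℂ) + (W : ℂ) * ((c : ℂ) / z) * ((x : ℂ) / (c : ℂ)) = (z + (W : ℂ) * (x : ℂ)) / z := by
    field_simp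
  rw [key]
  field_simp

/-- **The shifted denominator stays of size `Λ` on the closed shell**: `Λ²/4 ≤ ω² + e₂²`, `|w| ≤ 1`, `|x| ≤ Λ/4` ⟹ `Λ/6 ≤ ‖−iω + (e₂ + w·x)‖`.
[cite: BenfattoGiulianiMastropietro2006, §2.2 (2.27)–(2.28)] -/
theorem norm_shiftDen_resummed_ge (hΛ : 0 < Λ) {e₂ w x : ℝ} (hshell : Λ ^ 2 / 4 ≤ ω ^ 2 + e₂ ^ 2) (hw : |w| ≤ 1) (hx : |x| ≤ Λ / 4) :
    Λ / 6 ≤ ‖-I * ((ω + 0 : ℝ) : ℂ) + ((e₂ + w * x : ℝ) : ℂ)‖ := by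
  have hsq : ‖-I * ((ω + 0 : ℝ) : ℂ) + ((e₂ + w * x : ℝ) : ℂ)‖ ^ 2 = ω ^ 2 + (e₂ + w * x) ^ 2 := norm_sq_uvDen _ _
  have hwx : |w * x| ≤ Λ / 4 := by
    rw [abs_mul]
    calc |w| * |x| ≤ 1 * (Λ / 4) := mul_le_mul hw hx (abs_nonneg _) zero_le_one
      _ = Λ / 4 := one_mul _
  refine (abs_le_of_sq_le_sq' ?_ (norm_nonneg _)).2
  rw [hsq]
  -- either `|ω| ≥ Λ/6` or `|e₂| ≥ (√8/6)Λ`, whence `|e₂ + wx| ≥ |e₂| − Λ/4`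
  by_cases hωb : (Λ / 6) ^ 2 ≤ ω ^ 2
  · nlinarith [sq_nonneg (e₂ + w * x)]
  · have he : 8 * Λ ^ 2 / 36 ≤ e₂ ^ 2 := by nlinarith
    have hwx2 := abs_le.1 hwx
    have he2 : (4 / 9 : ℝ) * Λ ≤ |e₂| := by
      have h2 : ((4 / 9 : ℝ) * Λ) ^ 2 ≤ |e₂| ^ 2 := by rw [sq_abs]; nlinarith
      exact (pow_le_pow_iff_left₀ (by positivity) (abs_nonneg _) two_ne_zero).1 h2
    -- `|e₂ + wx| ≥ |e₂| − |wx| ≥ (4/9 − 1/4)Λ = 7Λ/36 ≥ Λ/6`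
    have h3 : (7 / 36 : ℝ) * Λ ≤ |e₂ + w * x| := by
      have := abs_sub_abs_le_abs_sub e₂ (-(w * x))
      rw [sub_neg_eq_add, abs_neg] at this
      linarith
    have h4 : ((7 / 36 : ℝ) * Λ) ^ 2 ≤ (e₂ + w * x) ^ 2 := by
      rw [← sq_abs (e₂ + w * x)]; exact pow_le_pow_left₀ (by positivity) h3 2
    nlinarith [sq_nonneg ω]

/-! ## §2 Jets of the weight along a band, of the shifted band, and of the resummed symbol -/

section Jets

variable {E : Type*} [NormedAddCommGroup E] [NormedSpace ℝ E]

/-- **Weight along a band**: `‖Dⁱ(w(ω, u ·))(p)‖ ≤ (i!)²·X·(4E_u/Λ)ⁱ` for `‖Dʲu(p)‖ ≤ E_uʲ` (`1 ≤ j ≤ i`), `Λ ≤ 4`, cutoff table up to `i`.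
[cite: BenfattoGiulianiMastropietro2006, §2.2 (2.36aa)] -/
theorem norm_iteratedFDeriv_weight_comp_le (hΛ : 0 < Λ) (hΛ4 : Λ ≤ 4) (ω : ℝ) {i : ℕ} {X : ℝ}
    (hX : ∀ l ≤ i, ∀ x : ℝ, ‖iteratedFDeriv ℝ l salmhoferCutoff x‖ ≤ X) {u : E → ℝ} (hu : ContDiff ℝ i u) {Eu : ℝ} (p : E)
    (hDu : ∀ j, 1 ≤ j → j ≤ i → ‖iteratedFDeriv ℝ j u p‖ ≤ Eu ^ j) :
    ‖iteratedFDeriv ℝ i (fun q : E => uvWeightFn Λ ω (u q)) p‖ ≤ (i.factorial : ℝ) ^ 2 * X * (4 * Eu / Λ) ^ i := by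
  have hX0 : 0 ≤ X := (norm_nonneg _).trans (hX 0 (Nat.zero_le _) 0)
  have h4Λ : 1 ≤ 4 / Λ := by rw [le_div_iff₀ hΛ]; linarith
  have hcomp : (fun q : E => uvWeightFn Λ ω (u q)) = (fun t : ℝ => uvWeightFn Λ ω t) ∘ u := rfl
  rw [hcomp]
  have hC : ∀ j, j ≤ i → ‖iteratedFDeriv ℝ j (fun t : ℝ => uvWeightFn Λ ω t) (u p)‖ ≤ i.factorial * X * (4 / Λ) ^ i := by
    intro j hj
    refine (norm_iteratedFDeriv_uvWeightFn_band_le_geometric hΛ ω (fun l hl x => hX l (hl.trans hj) x) (u p)).trans ?_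
    have hjf : (j.factorial : ℝ) ≤ i.factorial := by exact_mod_cast Nat.factorial_le hj
    have hpw : (4 / Λ : ℝ) ^ j ≤ (4 / Λ) ^ i := pow_le_pow_right₀ h4Λ hj
    exact mul_le_mul (mul_le_mul_of_nonneg_right hjf hX0) hpw (by positivity) (by positivity)
  refine (norm_iteratedFDeriv_comp_le (N := (i : ℕ∞)) (contDiff_uvWeightFn_band Λ ω) hu le_rfl p hC hDu).trans (le_of_eq ?_)
  rw [show (4 : ℝ) * Eu / Λ = 4 / Λ * Eu by ring, mul_pow, sq]
  ring

/-- **The shifted band `φ = u + w(ω,u)·v`**: `‖Dʲφ(p)‖ ≤ ((1 + δX)·(n!)²·(E_u + F_v + 4E_u/Λ))ʲ` for `1 ≤ j ≤ n`, given `‖Dʲu‖ ≤ E_uʲ` (`1 ≤ j`),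
`‖Dʲv‖ ≤ δ·F_vʲ` (all `j ≤ n`), `E_u, F_v ≥ 1`, `0 ≤ δ`, `Λ ≤ 4`. [cite: BenfattoGiulianiMastropietro2006, §2.2 (2.36aa)] -/
theorem norm_iteratedFDeriv_shiftedBand_le (hΛ : 0 < Λ) (hΛ4 : Λ ≤ 4) (ω : ℝ) {n : ℕ} {X : ℝ}
    (hX : ∀ l ≤ n, ∀ x : ℝ, ‖iteratedFDeriv ℝ l salmhoferCutoff x‖ ≤ X) {u v : E → ℝ} (hu : ContDiff ℝ n u) (hv : ContDiff ℝ n v)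
    {Eu Fv δ : ℝ} (hEu : 1 ≤ Eu) (hFv : 1 ≤ Fv) (hδ : 0 ≤ δ) (p : E)
    (hDu : ∀ j, 1 ≤ j → j ≤ n → ‖iteratedFDeriv ℝ j u p‖ ≤ Eu ^ j) (hDv : ∀ j ≤ n, ‖iteratedFDeriv ℝ j v p‖ ≤ δ * Fv ^ j)
    {j : ℕ} (hj1 : 1 ≤ j) (hjn : j ≤ n) :
    ‖iteratedFDeriv ℝ j (fun q : E => u q + uvWeightFn Λ ω (u q) * v q) p‖ ≤
      ((1 + δ * X) * (n.factorial : ℝ) ^ 2 * (Eu + Fv + 4 * Eu / Λ)) ^ j := by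
  have hX0 : 0 ≤ X := (norm_nonneg _).trans (hX 0 (Nat.zero_le _) 0)
  have hw : ContDiff ℝ n (fun q : E => uvWeightFn Λ ω (u q)) := (contDiff_uvWeightFn_band Λ ω).comp hu
  have hwv : ContDiff ℝ n (fun q : E => uvWeightFn Λ ω (u q) * v q) := hw.mul hv
  have hjN : (j : WithTop ℕ∞) ≤ n := by exact_mod_cast hjn
  -- the product term by Leibniz
  have hprod : ‖iteratedFDeriv ℝ j (fun q : E => uvWeightFn Λ ω (u q) * v q) p‖ ≤ δ * X * (j.factorial : ℝ) ^ 2 * (4 * Eu / Λ + Fv) ^ j := by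
    refine (norm_iteratedFDeriv_mul_le hw hv p hjN).trans ?_
    have hterm : ∀ i ∈ range (j + 1), (j.choose i : ℝ) * ‖iteratedFDeriv ℝ i (fun q : E => uvWeightFn Λ ω (u q)) p‖ *
        ‖iteratedFDeriv ℝ (j - i) v p‖ ≤ δ * X * (j.factorial : ℝ) ^ 2 * ((j.choose i : ℝ) * (4 * Eu / Λ) ^ i * Fv ^ (j - i)) := by
      intro i hi
      have hij : i ≤ j := Nat.lt_succ_iff.1 (mem_range.1 hi)
      have h1 := norm_iteratedFDeriv_weight_comp_le hΛ hΛ4 ω (fun l hl x => hX l (hl.trans (hij.trans hjn)) x) (hu.of_le (by exact_mod_cast hij.trans hjn))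
        p (fun k hk1 hk => hDu k hk1 (hk.trans (hij.trans hjn)))
      have h2 := hDv (j - i) ((Nat.sub_le j i).trans hjn)
      have hif : ((i.factorial : ℝ)) ^ 2 ≤ (j.factorial : ℝ) ^ 2 := by
        have : (i.factorial : ℝ) ≤ j.factorial := by exact_mod_cast Nat.factorial_le hij
        gcongr
      calc (j.choose i : ℝ) * ‖iteratedFDeriv ℝ i (fun q : E => uvWeightFn Λ ω (u q)) p‖ * ‖iteratedFDeriv ℝ (j - i) v p‖
          ≤ (j.choose i : ℝ) * ((i.factorial : ℝ) ^ 2 * X * (4 * Eu / Λ) ^ i) * (δ * Fv ^ (j - i)) := by gcongr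
        _ ≤ (j.choose i : ℝ) * ((j.factorial : ℝ) ^ 2 * X * (4 * Eu / Λ) ^ i) * (δ * Fv ^ (j - i)) := by gcongr
        _ = δ * X * (j.factorial : ℝ) ^ 2 * ((j.choose i : ℝ) * (4 * Eu / Λ) ^ i * Fv ^ (j - i)) := by ring
    refine (sum_le_sum hterm).trans (le_of_eq ?_)
    rw [← mul_sum, add_pow]
    congr 1
    exact sum_congr rfl fun i _ => by ring
  -- assemble with the `u` term
  rw [fun_iteratedFDeriv_add_apply (hu.contDiffAt.of_le hjN) (hwv.contDiffAt.of_le hjN)]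
  refine (norm_add_le _ _).trans ?_
  have hA : Eu ^ j + δ * X * (j.factorial : ℝ) ^ 2 * (4 * Eu / Λ + Fv) ^ j ≤
      ((1 + δ * X) * (n.factorial : ℝ) ^ 2 * (Eu + Fv + 4 * Eu / Λ)) ^ j := by
    set S : ℝ := Eu + Fv + 4 * Eu / Λ with hS
    have hpos : 0 ≤ Fv + 4 * Eu / Λ := by positivity
    have hS1 : Eu ≤ S := by rw [hS]; linarith
    have hS2 : 4 * Eu / Λ + Fv ≤ S := by rw [hS]; linarith
    have hS0 : 0 ≤ S := le_trans (zero_le_one.trans hEu) hS1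
    have hnf : (1 : ℝ) ≤ (n.factorial : ℝ) ^ 2 := one_le_pow₀ (by exact_mod_cast Nat.one_le_iff_ne_zero.2 (Nat.factorial_ne_zero n))
    have hjf : (j.factorial : ℝ) ^ 2 ≤ ((n.factorial : ℝ) ^ 2) ^ j := by
      have h1 : (j.factorial : ℝ) ≤ n.factorial := by exact_mod_cast Nat.factorial_le hjn
      calc (j.factorial : ℝ) ^ 2 ≤ (n.factorial : ℝ) ^ 2 := by gcongr
        _ = ((n.factorial : ℝ) ^ 2) ^ 1 := (pow_one _).symm
        _ ≤ ((n.factorial : ℝ) ^ 2) ^ j := pow_le_pow_right₀ hnf hj1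
    have h1X : (1 : ℝ) ≤ 1 + δ * X := le_add_of_nonneg_right (by positivity)
    have hEuj : Eu ^ j ≤ S ^ j := pow_le_pow_left₀ (zero_le_one.trans hEu) hS1 j
    have hSj : (4 * Eu / Λ + Fv) ^ j ≤ S ^ j := pow_le_pow_left₀ (by positivity) hS2 j
    have hmid : δ * X * (j.factorial : ℝ) ^ 2 * (4 * Eu / Λ + Fv) ^ j ≤ δ * X * ((n.factorial : ℝ) ^ 2) ^ j * S ^ j := by gcongr
    have hcoef : 1 + δ * X * ((n.factorial : ℝ) ^ 2) ^ j ≤ ((1 + δ * X) * (n.factorial : ℝ) ^ 2) ^ j := by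
      rw [mul_pow]
      have hpow1 : (1 : ℝ) ≤ (1 + δ * X) ^ j := one_le_pow₀ h1X
      have hnfj : (1 : ℝ) ≤ ((n.factorial : ℝ) ^ 2) ^ j := one_le_pow₀ hnf
      have hδX : 0 ≤ δ * X := by positivity
      have hB : 1 + δ * X ≤ (1 + δ * X) ^ j := by
        calc 1 + δ * X = (1 + δ * X) ^ 1 := (pow_one _).symm
          _ ≤ (1 + δ * X) ^ j := pow_le_pow_right₀ h1X hj1
      have hN0 : (0 : ℝ) ≤ ((n.factorial : ℝ) ^ 2) ^ j := by positivity
      have hprod := mul_le_mul_of_nonneg_right hB hN0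
      nlinarith
    calc Eu ^ j + δ * X * (j.factorial : ℝ) ^ 2 * (4 * Eu / Λ + Fv) ^ j
        ≤ S ^ j + δ * X * ((n.factorial : ℝ) ^ 2) ^ j * S ^ j := add_le_add hEuj hmid
      _ = (1 + δ * X * ((n.factorial : ℝ) ^ 2) ^ j) * S ^ j := by ring
      _ ≤ ((1 + δ * X) * (n.factorial : ℝ) ^ 2) ^ j * S ^ j := mul_le_mul_of_nonneg_right hcoef (pow_nonneg hS0 j)
      _ = ((1 + δ * X) * (n.factorial : ℝ) ^ 2 * S) ^ j := by rw [← mul_pow]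
  exact (add_le_add (hDu j hj1 hjn) hprod).trans hA

/-- **JETS OF THE RESUMMED SYMBOL ALONG THE FRAMES.**  `Λ ≤ 4`, `ω ≠ 0`, cutoff table `‖χ₂^{(l)}‖ ≤ X` (`l ≤ n`, `1 ≤ X`), bands `u, v ∈ Cⁿ(E)` with
`‖Dʲu(p)‖ ≤ E_uʲ` (`1 ≤ j ≤ n`), `‖Dʲv(p)‖ ≤ δ·F_vʲ` (`j ≤ n`), `|v(p)| ≤ δ ≤ Λ/4`, `E_u, F_v ≥ 1`.  Then, with `D_φ = (1 + δX)·(n!)²·(E_u + F_v + 4E_u/Λ)`,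
`‖Dⁿ[q ↦ w(ω,u q)·resolventFnXi c 0 ω (u q + w(ω,u q)·v q)](p)‖ ≤ |c|·X·(n!)³·(6/Λ)^{n+1}·(4E_u/Λ + D_φ)ⁿ`.
[cite: BenfattoGiulianiMastropietro2006, §2.2 (2.36aa)] -/
theorem norm_iteratedFDeriv_uvResummed_comp_le (hΛ : 0 < Λ) (hΛ4 : Λ ≤ 4) (hω : ω ≠ 0) {n : ℕ} {X : ℝ} (hX1 : 1 ≤ X)
    (hX : ∀ l ≤ n, ∀ x : ℝ, ‖iteratedFDeriv ℝ l salmhoferCutoff x‖ ≤ X) {u v : E → ℝ} (hu : ContDiff ℝ n u) (hv : ContDiff ℝ n v)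
    {Eu Fv δ : ℝ} (hEu : 1 ≤ Eu) (hFv : 1 ≤ Fv) (hδ : 0 ≤ δ) (hδΛ : δ ≤ Λ / 4) (p : E) (hvp : |v p| ≤ δ)
    (hDu : ∀ j, 1 ≤ j → j ≤ n → ‖iteratedFDeriv ℝ j u p‖ ≤ Eu ^ j) (hDv : ∀ j ≤ n, ‖iteratedFDeriv ℝ j v p‖ ≤ δ * Fv ^ j) :
    ‖iteratedFDeriv ℝ n (fun q : E => ((uvWeightFn Λ ω (u q) : ℝ) : ℂ) * resolventFnXi c 0 ω (u q + uvWeightFn Λ ω (u q) * v q)) p‖ ≤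
      |c| * X * (n.factorial : ℝ) ^ 3 * (6 / Λ) ^ (n + 1) *
        (4 * Eu / Λ + (1 + δ * X) * (n.factorial : ℝ) ^ 2 * (Eu + Fv + 4 * Eu / Λ)) ^ n := by
  have hω0 : ω + 0 ≠ 0 := by rwa [add_zero]
  have hX0 : 0 ≤ X := zero_le_one.trans hX1
  set Dφ : ℝ := (1 + δ * X) * (n.factorial : ℝ) ^ 2 * (Eu + Fv + 4 * Eu / Λ) with hDφ
  have hDφ0 : 0 ≤ Dφ := by rw [hDφ]; positivity
  have hRHS0 : 0 ≤ |c| * X * (n.factorial : ℝ) ^ 3 * (6 / Λ) ^ (n + 1) * (4 * Eu / Λ + Dφ) ^ n := by positivity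
  -- smoothness of the pieces
  have hwR : ContDiff ℝ n (fun q : E => uvWeightFn Λ ω (u q)) := (contDiff_uvWeightFn_band Λ ω).comp hu
  have hwC : ContDiff ℝ n (fun q : E => ((uvWeightFn Λ ω (u q) : ℝ) : ℂ)) := Complex.ofRealCLM.contDiff.comp hwR
  have hφ : ContDiff ℝ n (fun q : E => u q + uvWeightFn Λ ω (u q) * v q) := hu.add (hwR.mul hv)
  have hRφ : ContDiff ℝ n (fun q : E => resolventFnXi c 0 ω (u q + uvWeightFn Λ ω (u q) * v q)) :=
    (contDiff_resolventFnXi (c := c) hω0).comp hφ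
  by_cases hshell : ω ^ 2 + u p ^ 2 < Λ ^ 2 / 4
  · -- below the shell the weight vanishes identically near `p`, hence so does the function
    have hopen : ∀ᶠ q in nhds p, ω ^ 2 + u q ^ 2 < Λ ^ 2 / 4 :=
      (continuous_const.add ((hu.continuous).pow 2)).continuousAt.eventually (gt_mem_nhds hshell)
    have hev : (fun q : E => ((uvWeightFn Λ ω (u q) : ℝ) : ℂ) * resolventFnXi c 0 ω (u q + uvWeightFn Λ ω (u q) * v q)) =ᶠ[nhds p]
        fun _ => (0 : ℂ) := by
      filter_upwards [hopen] with q hq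
      have hw0 : uvWeightFn Λ ω (u q) = 0 := (uvWeightFn_eq_zero_of_lt hΛ (e := ω) (ω := u q) (by linarith)).1
      rw [hw0, Complex.ofReal_zero, zero_mul]
    rw [(hev.iteratedFDeriv ℝ n).eq_of_nhds]
    rcases Nat.eq_zero_or_pos n with hn | hn
    · subst hn; simpa using hRHS0
    · rw [iteratedFDeriv_const_of_ne (Nat.pos_iff_ne_zero.1 hn)]
      simpa using hRHS0
  · have hge : Λ ^ 2 / 4 ≤ ω ^ 2 + u p ^ 2 := not_lt.1 hshell
    -- the resolvent jets at the shifted band value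
    have hden : Λ / 6 ≤ ‖-I * ((ω + 0 : ℝ) : ℂ) + ((u p + uvWeightFn Λ ω (u p) * v p : ℝ) : ℂ)‖ :=
      norm_shiftDen_resummed_ge hΛ hge (abs_uvWeightFn_le_one Λ ω (u p)) (hvp.trans hδΛ)
    have h6Λ : 0 < Λ / 6 := by positivity
    have hC : ∀ j, j ≤ n → ‖iteratedFDeriv ℝ j (resolventFnXi c 0 ω) (u p + uvWeightFn Λ ω (u p) * v p)‖ ≤
        |c| * n.factorial * (6 / Λ) ^ (n + 1) := by
      intro j hj
      rw [norm_iteratedFDeriv_eq_norm_iteratedDeriv, norm_iteratedDeriv_resolventFnXi hω0]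
      have hjf : (j.factorial : ℝ) ≤ n.factorial := by exact_mod_cast Nat.factorial_le hj
      have h1 : (Λ / 6) ^ (j + 1) ≤ ‖-I * ((ω + 0 : ℝ) : ℂ) + ((u p + uvWeightFn Λ ω (u p) * v p : ℝ) : ℂ)‖ ^ (j + 1) :=
        pow_le_pow_left₀ h6Λ.le hden _
      have h6 : (1 : ℝ) ≤ 6 / Λ := by rw [le_div_iff₀ hΛ]; linarith
      calc |c| * (j.factorial : ℝ) / ‖-I * ((ω + 0 : ℝ) : ℂ) + ((u p + uvWeightFn Λ ω (u p) * v p : ℝ) : ℂ)‖ ^ (j + 1)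
          ≤ |c| * (n.factorial : ℝ) / (Λ / 6) ^ (j + 1) := by gcongr
        _ = |c| * (n.factorial : ℝ) * (6 / Λ) ^ (j + 1) := by rw [div_eq_mul_inv, ← inv_pow, inv_div]
        _ ≤ |c| * (n.factorial : ℝ) * (6 / Λ) ^ (n + 1) := mul_le_mul_of_nonneg_left (pow_le_pow_right₀ h6 (by omega)) (by positivity)
    -- jets of `R ∘ φ`
    have hRcomp : ∀ k, k ≤ n → ‖iteratedFDeriv ℝ k (fun q : E => resolventFnXi c 0 ω (u q + uvWeightFn Λ ω (u q) * v q)) p‖ ≤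
        k.factorial * (|c| * n.factorial * (6 / Λ) ^ (n + 1)) * Dφ ^ k := by
      intro k hk
      have hcompφ : (fun q : E => resolventFnXi c 0 ω (u q + uvWeightFn Λ ω (u q) * v q)) =
          resolventFnXi c 0 ω ∘ (fun q : E => u q + uvWeightFn Λ ω (u q) * v q) := rfl
      rw [hcompφ]
      refine norm_iteratedFDeriv_comp_le (N := (k : ℕ∞)) (contDiff_resolventFnXi (c := c) hω0) (hφ.of_le (by exact_mod_cast hk)) le_rfl p
        (fun j hj => hC j (hj.trans hk)) ?_
      intro j hj1 hjk
      exact norm_iteratedFDeriv_shiftedBand_le hΛ hΛ4 ω hX hu hv hEu hFv hδ p hDu hDv hj1 (hjk.trans hk)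
    -- jets of the weight factor (complex cast)
    have hWcomp : ∀ i, i ≤ n → ‖iteratedFDeriv ℝ i (fun q : E => ((uvWeightFn Λ ω (u q) : ℝ) : ℂ)) p‖ ≤ (i.factorial : ℝ) ^ 2 * X * (4 * Eu / Λ) ^ i := by
      intro i hi
      have hcast : (fun q : E => ((uvWeightFn Λ ω (u q) : ℝ) : ℂ)) = Complex.ofRealLI ∘ (fun q : E => uvWeightFn Λ ω (u q)) := rfl
      rw [hcast, Complex.ofRealLI.norm_iteratedFDeriv_comp_left ((hwR.of_le (by exact_mod_cast hi)).contDiffAt) le_rfl]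
      exact norm_iteratedFDeriv_weight_comp_le hΛ hΛ4 ω (fun l hl x => hX l (hl.trans hi) x) (hu.of_le (by exact_mod_cast hi)) p
        (fun j hj1 hj => hDu j hj1 (hj.trans hi))
    -- Leibniz
    refine (norm_iteratedFDeriv_mul_le hwC hRφ p (n := n) le_rfl).trans ?_
    have hterm : ∀ i ∈ range (n + 1), (n.choose i : ℝ) * ‖iteratedFDeriv ℝ i (fun q : E => ((uvWeightFn Λ ω (u q) : ℝ) : ℂ)) p‖ *
        ‖iteratedFDeriv ℝ (n - i) (fun q : E => resolventFnXi c 0 ω (u q + uvWeightFn Λ ω (u q) * v q)) p‖ ≤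
        |c| * X * (n.factorial : ℝ) ^ 3 * (6 / Λ) ^ (n + 1) * ((n.choose i : ℝ) * (4 * Eu / Λ) ^ i * Dφ ^ (n - i)) := by
      intro i hi
      have hin : i ≤ n := Nat.lt_succ_iff.1 (mem_range.1 hi)
      have h1 := hWcomp i hin
      have h2 := hRcomp (n - i) (Nat.sub_le n i)
      have hfi : ((i.factorial : ℝ)) ^ 2 * ((n - i).factorial : ℝ) * n.factorial ≤ (n.factorial : ℝ) ^ 3 := by
        have ha : (i.factorial : ℝ) * ((n - i).factorial : ℝ) ≤ n.factorial := by
          have h := Nat.le_of_dvd (Nat.factorial_pos _) (Nat.factorial_mul_factorial_dvd_factorial_add i (n - i))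
          rw [Nat.add_sub_cancel' hin] at h
          exact_mod_cast h
        have hb : (i.factorial : ℝ) ≤ n.factorial := by exact_mod_cast Nat.factorial_le hin
        have h0 : (0 : ℝ) ≤ n.factorial := Nat.cast_nonneg _
        calc (i.factorial : ℝ) ^ 2 * ((n - i).factorial : ℝ) * n.factorial = i.factorial * (i.factorial * (n - i).factorial) * n.factorial := by ring
          _ ≤ n.factorial * n.factorial * n.factorial := by gcongr
          _ = (n.factorial : ℝ) ^ 3 := by ring
      calc (n.choose i : ℝ) * ‖iteratedFDeriv ℝ i (fun q : E => ((uvWeightFn Λ ω (u q) : ℝ) : ℂ)) p‖ *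
            ‖iteratedFDeriv ℝ (n - i) (fun q : E => resolventFnXi c 0 ω (u q + uvWeightFn Λ ω (u q) * v q)) p‖
          ≤ (n.choose i : ℝ) * ((i.factorial : ℝ) ^ 2 * X * (4 * Eu / Λ) ^ i) *
              ((n - i).factorial * (|c| * n.factorial * (6 / Λ) ^ (n + 1)) * Dφ ^ (n - i)) := by gcongr
        _ = |c| * X * ((i.factorial : ℝ) ^ 2 * ((n - i).factorial : ℝ) * n.factorial) * (6 / Λ) ^ (n + 1) *
              ((n.choose i : ℝ) * (4 * Eu / Λ) ^ i * Dφ ^ (n - i)) := by ring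
        _ ≤ |c| * X * (n.factorial : ℝ) ^ 3 * (6 / Λ) ^ (n + 1) * ((n.choose i : ℝ) * (4 * Eu / Λ) ^ i * Dφ ^ (n - i)) := by gcongr
    refine (sum_le_sum hterm).trans (le_of_eq ?_)
    rw [← mul_sum, add_pow]
    congr 1
    exact sum_congr rfl fun i _ => by ring

end Jets

end Literature.MathematicalPhysics.QuantumLattice

end
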